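import Summits.BirchSwinnertonDyer.BirchSwinnertonDyer.Theorems.PrintCFramBottomClassIndexLawFiveLeBorelMcCallumProp31
import HarnessLib

/-!
# Route `PrintCFram`, crux C2 `BottomClassIndexLawFiveLe` (stmt-BirchSwinnertonDyer-20372), line
# `eisenstein-resource-bdp-line` (S2 `stub_kolyvaginUpper_borelCM_pairSum`, structure at level `p^M`):
# **`W[p^M]` is UNISERIAL over every number field of degree `< p`** — its `Γ_{K''}`-stable subgroups
# are exactly the `𝔭`-power torsions `W[𝔭^k] = ker μ^k`, `0 ≤ k ≤ 2M`
# (cell `bsd-print-cfram`, seat `bsd-line-cfram-p1-w2` g5; helper `--supports` 20372; 0 facts, 0 defs)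

HONEST FRAMING. Nothing about BSD is proved here, and nothing of S2 itself. File 8b proved the
level-`p` trichotomy (`0 / W[𝔭] / W[p]`); this file is the level-`p^M` statement the
`𝓞_𝔭`-bookkeeping of S2 works with: every subgroup of `W[p^M]` stable under `res Γ_{K''}`
(`[K'' : ℚ] < p`) is one of the `2M + 1` members of the chain
`0 = ker μ⁰ ⊂ ker μ = W[𝔭] ⊂ ker μ² = W[p] ⊂ ⋯ ⊂ ker μ^{2M} = W[p^M]` — in particular it is an
`𝓞 = ℤ[√−p]`-submodule, so Selmer structures, Kummer images and evaluation images at the Borel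
prime are automatically `𝓞_𝔭`-modules, filtered by `𝔭`-adic (not `p`-adic) depth.
* §1 abstract (`π : T →+ T`, `# ker π = p` prime): `eq_ker_pow_of_stable_of_not_le` (a `π`-stable
  `H` with `H ≤ ker π^e`, `H ≰ ker π^{e−1}` is `ker π^e` — the `𝔭`-adic tower
  `eq_pi_ker_of_stable_of_indep_top` of file 8d with one index), `exists_eq_ker_pow_of_stable`
  (every `π`-stable `H ≤ ker π^N` is `ker π^e` for some `e ≤ N`).
* §2 leaf, `ℚ̄`-side: `exists_forall_mem_iff_pow_apply_eq_zero_of_cmRamified` — `W/ℚ` CM, `p ≥ 5`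
  CM-ramified, `μ = √−p` commuting with the `√−p`-fixing elements, `[K'' : ℚ] < p`, `M ≥ 1`: a
  subgroup `H ≤ W[p^M]` of `W(ℚ̄)` stable under `res Γ_{K''}` is `{P ∈ W[p^M] : μ^k P = 0}` for some
  `k ≤ 2M` (μ-stability from the non-scalar `A + Bμ`, `p ∤ B`, of file 8e).
* §3 machine currency: `exists_forall_mem_iff_pow_apply_eq_zero_baseChange_of_cmRamified` — the same
  for `Γ_{K''}`-stable subgroups of `W(K̄'')[p^M]` along `θ = RatClosure.torsionEquiv`.
THEOREMS ONLY; no definition, no named fact, no `sorry`. BSD is not proved by any of this; no summit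
statement is proved by this seat.
References: [Rubin1999] Prop. 5.4, Cor. 5.5 (`E[𝔭ⁿ] ≅ 𝒪/𝔭ⁿ`); [GrossLMS1991] §9; [McCallumLMS1991] §3.
-/

set_option autoImplicit false
-- `…BirchSwinnertonDyer.BirchSwinnertonDyer.Theorems…` is the problem's mandated namespace (D-0017).
set_option linter.dupNamespace false

noncomputable section

open scoped Classical

namespace Summit.BirchSwinnertonDyer.BirchSwinnertonDyer.Theorems.PrintCFram.BorelKolyvaginPairing

open WeierstrassCurve Field Literature.NumberTheory.EllipticCurves
  Literature.NumberTheory.EllipticCurves.KolyvaginPairing Literature.NumberTheory.GaloisRepresentations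
  Literature.NumberTheory.EllipticCurves.Rank1Residual
  Summit.BirchSwinnertonDyer.BirchSwinnertonDyer.Theorems.PrintCFram.BorelHomothety

/-! ## §1 Abstract: `π`-stable subgroups of `ker π^N` are the `ker π^e` -/

section Abstract

variable {T : Type*} [AddCommGroup T] (π : AddMonoid.End T) {p : ℕ}

/-- Membership in `ker πⁿ`, with `πⁿ` applied as an element of `End T`. [folklore] -/
theorem mem_ker_pow_iff (n : ℕ) (x : T) : x ∈ AddMonoidHom.ker (π ^ n) ↔ (π ^ n) x = 0 :=
  AddMonoidHom.mem_ker

/-- Membership in `ker π`, with `π` applied as an element of `End T`. [folklore] -/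
theorem mem_ker_iff' (x : T) : x ∈ AddMonoidHom.ker π ↔ π x = 0 := AddMonoidHom.mem_ker

/-- **One index of the `𝔭`-adic tower.** `# ker π = p` prime; a `π`-stable subgroup `H ≤ ker π^e`
not contained in `ker π^{e−1}` is all of `ker π^e` (the tower theorem
`eq_pi_ker_of_stable_of_indep_top` over the one-point index set: the top-layer functional
`t ↦ c · π^{e−1} t ∈ ker π` vanishes on `H` only if `p ∣ c`, since `ker π` has prime order).
[cite: Rubin1999, Prop. 5.4] -/
theorem eq_ker_pow_of_stable_of_not_le (hp : p.Prime) (hker : Nat.card (AddMonoidHom.ker π) = p)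
    (H : AddSubgroup T) (hπ : ∀ t ∈ H, π t ∈ H) {e : ℕ}
    (hle : H ≤ AddMonoidHom.ker (π ^ e)) (hnot : ¬ H ≤ AddMonoidHom.ker (π ^ (e - 1))) :
    H = AddMonoidHom.ker (π ^ e) := by
  haveI : Fact p.Prime := ⟨hp⟩
  -- `H` as a subgroup of the functions `Unit → T`
  set J : AddSubgroup (Unit → T) := H.comap (Pi.evalAddMonoidHom (fun _ : Unit => T) ()) with hJ
  have hmemJ : ∀ m, m ∈ J ↔ m () ∈ H := fun m => Iff.rfl
  obtain ⟨t₀, ht₀H, ht₀⟩ := SetLike.not_le_iff_exists.mp hnot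
  rw [mem_ker_pow_iff] at ht₀
  have hte : (π ^ e) t₀ = 0 := (mem_ker_pow_iff π e t₀).mp (hle ht₀H)
  have he : 0 < e := by
    rcases Nat.eq_zero_or_pos e with rfl | h
    · exact absurd hte ht₀
    · exact h
  -- `π^{e-1} t₀` is a non-zero element of `ker π`, of order `p`
  have hX : (π ^ (e - 1)) t₀ ∈ AddMonoidHom.ker π := by
    rw [mem_ker_iff', ← pow_succ_apply, Nat.sub_add_cancel he]
    exact hte
  have hpX : p • (π ^ (e - 1)) t₀ = 0 := by
    have h := addOrderOf_dvd_natCard (⟨_, hX⟩ : AddMonoidHom.ker π)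
    rw [hker] at h
    have h' : p • (⟨_, hX⟩ : AddMonoidHom.ker π) = 0 := addOrderOf_dvd_iff_nsmul_eq_zero.mp h
    exact congrArg Subtype.val h'
  have hord : addOrderOf ((π ^ (e - 1)) t₀) = p := addOrderOf_eq_prime hpX ht₀
  have htop := eq_pi_ker_of_stable_of_indep_top π hp hker e (e := fun _ : Unit => e) (fun _ => le_rfl)
    J (fun m hm => (hmemJ _).mpr (hπ _ ((hmemJ m).mp hm)))
    (fun m hm => (mem_pi_ker_iff π _ m).mpr fun _ => (mem_ker_pow_iff π e _).mp (hle ((hmemJ m).mp hm)))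
    (fun c hc i _ => by
      have h := hc (fun _ => t₀) ((hmemJ _).mpr ht₀H)
      rw [Fintype.sum_unique] at h
      have hdvd := (addOrderOf_dvd_iff_zsmul_eq_zero (x := (π ^ (e - 1)) t₀) (i := c default)).mpr h
      rw [hord] at hdvd
      obtain rfl : i = default := Subsingleton.elim i default
      exact hdvd)
  refine le_antisymm hle fun t ht => ?_
  have hmem : (fun _ : Unit => t) ∈ J := by
    rw [htop, mem_pi_ker_iff]
    exact fun _ => (mem_ker_pow_iff π e t).mp ht
  exact (hmemJ _).mp hmem

/-- **`π`-stable subgroups of `ker π^N` are the `ker π^e`, `e ≤ N`** (`# ker π = p` prime): take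
`e` minimal with `H ≤ ker π^e`. [cite: Rubin1999, Prop. 5.4] -/
theorem exists_eq_ker_pow_of_stable (hp : p.Prime) (hker : Nat.card (AddMonoidHom.ker π) = p)
    (H : AddSubgroup T) (hπ : ∀ t ∈ H, π t ∈ H) {N : ℕ} (hN : H ≤ AddMonoidHom.ker (π ^ N)) :
    ∃ e ≤ N, H = AddMonoidHom.ker (π ^ e) := by
  have hex : ∃ e, H ≤ AddMonoidHom.ker (π ^ e) := ⟨N, hN⟩
  refine ⟨Nat.find hex, Nat.find_min' hex hN, ?_⟩
  rcases Nat.eq_zero_or_pos (Nat.find hex) with h0 | hpos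
  · have hle : H ≤ AddMonoidHom.ker (π ^ Nat.find hex) := Nat.find_spec hex
    refine le_antisymm hle fun t ht => ?_
    rw [mem_ker_pow_iff, h0, pow_zero, AddMonoid.End.coe_one, id_eq] at ht
    rw [ht]; exact H.zero_mem
  · exact eq_ker_pow_of_stable_of_not_le π hp hker H hπ (Nat.find_spec hex)
      (Nat.find_min hex (Nat.sub_one_lt_of_lt hpos))

end Abstract

/-! ## §2 The leaf at level `p^M`, `ℚ̄`-side -/

section LeafPow

variable (W : WeierstrassCurve ℚ) [W.IsElliptic] (p : ℕ) [hp : Fact p.Prime]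

omit [W.IsElliptic] hp in
/-- `μ^{2M}` kills `W[p^M]` (`μ^{2M} = m^M = ± p^M`). [folklore] -/
theorem pow_two_mul_apply_eq_zero_of_mem {μ : AddMonoid.End W.geomPoints} {m : ℤ}
    (hμμ : ∀ P, μ (μ P) = m • P) (hm : m.natAbs = p) {M : ℕ} {P : W.geomPoints}
    (hP : P ∈ W.geomTorsion ((p ^ M : ℕ) : ℤ)) : (μ ^ (2 * M)) P = 0 := by
  rw [pow_two_mul_apply W hμμ]
  exact pow_zsmul_eq_zero_of_natAbs_eq p hm (by exact_mod_cast hP)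

/-- **`W[p^M]` is uniserial over every `K''` of degree `< p` (`ℚ̄`-side).** `W/ℚ` CM, `p ≥ 5`
CM-ramified, `μ = √−p` commuting with the `√−p`-fixing Galois elements (`exists_sqrt_end_of_cmRamified`),
`[K'' : ℚ] < p`, `M ≥ 1`: a subgroup `H ≤ W[p^M]` of `W(ℚ̄)` stable under `res Γ_{K''}` is
`W[𝔭^k] = {P ∈ W[p^M] : μ^k P = 0}` for some `k ≤ 2M`. (Some `g ∈ Γ_{K''}` acts as `A + Bμ` with
`p ∤ B` — file 8e — so `H` is `μ`-stable; then §1 for `μ|_{W[p^M]}`, `# ker = p`.)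
[cite: Rubin1999, Prop. 5.4, Cor. 5.5] -/
theorem exists_forall_mem_iff_pow_apply_eq_zero_of_cmRamified (hCM : W.HasCM) (h5 : 5 ≤ p)
    (hram : CMRamified W p) {s : AlgebraicClosure ℚ} {μ : AddMonoid.End W.geomPoints} {m : ℤ}
    (hs : s ^ 2 = ((-(p : ℤ) : ℤ) : AlgebraicClosure ℚ)) (hm : m.natAbs = p)
    (hμμ : ∀ P, μ (μ P) = m • P) (hcomm : ∀ g : absoluteGaloisGroup ℚ, g • s = s → ∀ P, μ (g • P) = g • μ P)
    (K : Type) [Field K] [NumberField K] (hK : Module.finrank ℚ K < p) {M : ℕ} (hM : 1 ≤ M)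
    {H : AddSubgroup W.geomPoints} (hHM : H ≤ W.geomTorsion ((p ^ M : ℕ) : ℤ))
    (hH : ∀ g : absoluteGaloisGroup K, ∀ P ∈ H, absGaloisRestrict ℚ K g • P ∈ H) :
    ∃ k ≤ 2 * M, ∀ P, P ∈ H ↔ P ∈ W.geomTorsion ((p ^ M : ℕ) : ℤ) ∧ (μ ^ k) P = 0 := by
  have hpr : p.Prime := hp.out
  have hp' : _root_.Prime (p : ℤ) := Nat.prime_iff_prime_int.mp hpr
  -- `μ` restricted to `W[p^M]`
  have hμmem : ∀ P ∈ W.geomTorsion ((p ^ M : ℕ) : ℤ), μ P ∈ W.geomTorsion ((p ^ M : ℕ) : ℤ) :=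
    fun P hP => apply_mem_torsionBy (μ : W.geomPoints →+ W.geomPoints) hP
  set μM : AddMonoid.End (W.geomTorsion ((p ^ M : ℕ) : ℤ)) :=
    { toFun := fun t => ⟨μ t, hμmem _ t.2⟩
      map_zero' := Subtype.ext (by change μ (0 : W.geomPoints) = 0; exact map_zero μ)
      map_add' := fun P Q => Subtype.ext (by
        change μ ((P : W.geomPoints) + Q) = μ P + μ Q; exact map_add μ _ _) } with hμM
  have hμMapp : ∀ t : W.geomTorsion ((p ^ M : ℕ) : ℤ),
      ((μM t : W.geomTorsion ((p ^ M : ℕ) : ℤ)) : W.geomPoints) = μ t := fun _ => rfl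
  have hpow : ∀ (k : ℕ) (t : W.geomTorsion ((p ^ M : ℕ) : ℤ)),
      (((μM ^ k) t : W.geomTorsion ((p ^ M : ℕ) : ℤ)) : W.geomPoints) = (μ ^ k) (t : W.geomPoints) := by
    intro k
    induction k with
    | zero => intro t; rfl
    | succ k ih => intro t; rw [pow_succ_apply, pow_succ_apply, hμMapp, ih]
  -- `# ker μM = p`
  have hne := exists_mem_geomTorsion_apply_ne_zero W p hμμ hm
  have hkerle : (μ : W.geomPoints →+ W.geomPoints).ker ≤ W.geomTorsion ((p ^ M : ℕ) : ℤ) :=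
    (ker_le_torsionBy (μ : W.geomPoints →+ W.geomPoints) hμμ hm).trans
      (W.geomTorsion_le_of_dvd (by exact_mod_cast dvd_pow_self p (by omega : M ≠ 0)))
  have hkerM : Nat.card (AddMonoidHom.ker μM) = p := by
    have hk := natCard_ker_eq (μ : W.geomPoints →+ W.geomPoints) hμμ hm hpr
      (W.natCard_geomTorsion_prime_eq_sq hpr) hne
    have hto : ∀ t : AddMonoidHom.ker μM,
        ((t : W.geomTorsion ((p ^ M : ℕ) : ℤ)) : W.geomPoints) ∈ (μ : W.geomPoints →+ W.geomPoints).ker := by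
      intro t
      have h := t.2
      rw [AddMonoidHom.mem_ker] at h
      rw [AddMonoidHom.mem_ker]
      exact (congrArg (fun x : W.geomTorsion ((p ^ M : ℕ) : ℤ) => (x : W.geomPoints)) h).trans
        (ZeroMemClass.coe_zero _)
    have hinv : ∀ P : (μ : W.geomPoints →+ W.geomPoints).ker,
        (⟨(P : W.geomPoints), hkerle P.2⟩ : W.geomTorsion ((p ^ M : ℕ) : ℤ)) ∈ AddMonoidHom.ker μM := by
      intro P
      have h := P.2
      rw [AddMonoidHom.mem_ker] at h
      rw [AddMonoidHom.mem_ker]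
      exact Subtype.ext h
    let ε : AddMonoidHom.ker μM ≃ (μ : W.geomPoints →+ W.geomPoints).ker :=
      { toFun := fun t => ⟨_, hto t⟩
        invFun := fun P => ⟨_, hinv P⟩
        left_inv := fun t => rfl
        right_inv := fun P => rfl }
    exact (Nat.card_congr ε).trans hk
  -- `H` inside the subtype, `μM`-stable through `A + Bμ`, `p ∤ B`
  set H₀ : AddSubgroup (W.geomTorsion ((p ^ M : ℕ) : ℤ)) :=
    H.addSubgroupOf (W.geomTorsion ((p ^ M : ℕ) : ℤ)) with hH₀
  have hmemH₀ : ∀ t : W.geomTorsion ((p ^ M : ℕ) : ℤ), t ∈ H₀ ↔ (t : W.geomPoints) ∈ H := fun t =>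
    AddSubgroup.mem_addSubgroupOf
  obtain ⟨g, A, B, hB, hAB⟩ :=
    exists_restrict_smul_eq_nonScalar_pow W p hCM h5 hram hs hm hμμ hcomm K hK hM
  have hπ : ∀ t ∈ H₀, μM t ∈ H₀ := by
    intro t ht
    rw [hmemH₀] at ht ⊢
    rw [hμMapp]
    -- `B μ t = g t - A t ∈ H`
    have h1 : B • μ (t : W.geomPoints) ∈ H := by
      have h := H.sub_mem (hH g _ ht) (H.zsmul_mem ht A)
      rwa [hAB _ t.2, add_sub_cancel_left] at h
    obtain ⟨u, v, huv⟩ := ((Prime.coprime_iff_not_dvd hp').mpr hB).pow_left (m := M)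
    have hμt : μ (t : W.geomPoints) ∈ W.geomTorsion ((p ^ M : ℕ) : ℤ) := hμmem _ t.2
    have hpM : ((p : ℤ) ^ M) • μ (t : W.geomPoints) = 0 := by exact_mod_cast hμt
    have : μ (t : W.geomPoints) = v • (B • μ (t : W.geomPoints)) + u • (((p : ℤ) ^ M) • μ (t : W.geomPoints)) := by
      rw [smul_smul, smul_smul, ← add_smul, add_comm, huv, one_smul]
    rw [this, hpM, smul_zero, add_zero]
    exact H.zsmul_mem h1 v
  have hN : H₀ ≤ AddMonoidHom.ker (μM ^ (2 * M)) := fun t _ => by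
    rw [mem_ker_pow_iff]
    exact Subtype.ext ((hpow _ t).trans (pow_two_mul_apply_eq_zero_of_mem W p hμμ hm t.2))
  obtain ⟨k, hk, hHk⟩ := exists_eq_ker_pow_of_stable μM hpr hkerM H₀ hπ hN
  refine ⟨k, hk, fun P => ⟨fun hP => ⟨hHM hP, ?_⟩, fun ⟨hPM, hPk⟩ => ?_⟩⟩
  · have h := (hmemH₀ ⟨P, hHM hP⟩).mpr hP
    rw [hHk, mem_ker_pow_iff] at h
    have := congrArg (fun x : W.geomTorsion ((p ^ M : ℕ) : ℤ) => (x : W.geomPoints)) h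
    rwa [hpow, ZeroMemClass.coe_zero] at this
  · have h : (⟨P, hPM⟩ : W.geomTorsion ((p ^ M : ℕ) : ℤ)) ∈ H₀ := by
      rw [hHk, mem_ker_pow_iff]
      exact Subtype.ext ((hpow k ⟨P, hPM⟩).trans (hPk.trans (ZeroMemClass.coe_zero _).symm))
    exact (hmemH₀ _).mp h

end LeafPow

/-! ## §3 Machine currency: `Γ_{K''}`-stable subgroups of `W(K̄'')[p^M]` -/

section MachinePow

variable (W : WeierstrassCurve ℚ) [W.IsElliptic] (p : ℕ) [hp : Fact p.Prime]
variable (K : Type) [Field K] [NumberField K]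

/-- **`W(K̄'')[p^M]` is uniserial as a `Γ_{K''}`-module (`[K'' : ℚ] < p`).** Every `Γ_{K''}`-stable
subgroup `H` of `W(K̄'')[p^M]` is `{t : μ^k(θ⁻¹ t) = 0}` for some `k ≤ 2M`
(`θ = RatClosure.torsionEquiv W (p^M)`): the `2M + 1` torsions `W[𝔭^k]` are the only stable
subgroups, so every Galois-stable structure inside `W[p^M]` at the Borel prime is an `𝓞_𝔭`-module
filtered by `𝔭`-adic depth. [cite: Rubin1999, Prop. 5.4, Cor. 5.5] -/
theorem exists_forall_mem_iff_pow_apply_eq_zero_baseChange_of_cmRamified (hCM : W.HasCM) (h5 : 5 ≤ p)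
    (hram : CMRamified W p) {s : AlgebraicClosure ℚ} {μ : AddMonoid.End W.geomPoints} {m : ℤ}
    (hs : s ^ 2 = ((-(p : ℤ) : ℤ) : AlgebraicClosure ℚ)) (hm : m.natAbs = p)
    (hμμ : ∀ P, μ (μ P) = m • P) (hcomm : ∀ g : absoluteGaloisGroup ℚ, g • s = s → ∀ P, μ (g • P) = g • μ P)
    (hK : Module.finrank ℚ K < p) {M : ℕ} (hM : 1 ≤ M)
    (H : AddSubgroup (geomTorsion (W.baseChange K) ((p ^ M : ℕ) : ℤ)))
    (hH : ∀ g : absoluteGaloisGroup K, ∀ t ∈ H, g • t ∈ H) :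
    ∃ k ≤ 2 * M, ∀ t, t ∈ H ↔
      (μ ^ k) ((RatClosure.torsionEquiv (K := K) W ((p ^ M : ℕ) : ℤ)).symm t : W.geomTorsion ((p ^ M : ℕ) : ℤ)) = 0 := by
  set θ := RatClosure.torsionEquiv (K := K) W ((p ^ M : ℕ) : ℤ) with hθ
  -- pull `H` back to a subgroup of `W(ℚ̄)` inside `W[p^M]`
  set H₀ : AddSubgroup (W.geomTorsion ((p ^ M : ℕ) : ℤ)) := H.comap θ.toAddMonoidHom with hH₀
  set H₁ : AddSubgroup W.geomPoints := H₀.map (W.geomTorsion ((p ^ M : ℕ) : ℤ)).subtype with hH₁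
  have hH₁le : H₁ ≤ W.geomTorsion ((p ^ M : ℕ) : ℤ) := AddSubgroup.map_subtype_le _
  have hmemH₁ : ∀ t : W.geomTorsion ((p ^ M : ℕ) : ℤ), (t : W.geomPoints) ∈ H₁ ↔ θ t ∈ H := by
    intro t
    constructor
    · rintro ⟨t', ht', htt'⟩
      have : t' = t := Subtype.ext htt'
      rw [← this]; exact ht'
    · intro ht; exact ⟨t, ht, rfl⟩
  have hH₁stab : ∀ g : absoluteGaloisGroup K, ∀ P ∈ H₁, absGaloisRestrict ℚ K g • P ∈ H₁ := by
    rintro g P ⟨t, ht, rfl⟩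
    have h := (hmemH₁ (absGaloisRestrict ℚ K g • t)).mpr (by
      rw [RatClosure.torsionEquiv_smul]; exact hH g _ ht)
    exact h
  obtain ⟨k, hk, hiff⟩ := exists_forall_mem_iff_pow_apply_eq_zero_of_cmRamified W p hCM h5 hram hs hm
    hμμ hcomm K hK hM hH₁le hH₁stab
  refine ⟨k, hk, fun t => ?_⟩
  obtain ⟨t₀, rfl⟩ := θ.surjective t
  rw [θ.symm_apply_apply, ← hmemH₁, hiff]
  exact ⟨fun h => h.2, fun h => ⟨t₀.2, h⟩⟩

end MachinePow

end Summit.BirchSwinnertonDyer.BirchSwinnertonDyer.Theorems.PrintCFram.BorelKolyvaginPairing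

end
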